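import Mathlib
import Literature.Probability.MarkovChains.TotalVariation
import Summits.Ventures.LatticeQCDFlow.Scaling.ImportanceWeights
import Summits.Ventures.LatticeQCDFlow.Scaling.Pseudofermions
import Summits.Ventures.LatticeQCDFlow.Scaling.BlockDefect
import Summits.Ventures.LatticeQCDFlow.Scaling.CovDefect
import Summits.Ventures.LatticeQCDFlow.Scaling.HierarchicalVolumeLaw

/-!
# LatticeQCDFlow / Scaling — the hierarchical volume law, companion: the conditional defect from
# a conditional correlator, and exactness for Markov targets (T2-AJ, item 119b)

HONEST FRAMING: exact (Metropolis-corrected) sampling algorithms for lattice gauge theory;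
figures of merit are autocorrelation/cost numbers at stated couplings and volumes; no
continuum-physics claim.

Venture `LatticeQCDFlow` (cell pub-lqcd), topic `Scaling`, item 119b of HOME/THEORY-2.md §3.1 (hv)
/ §4 row T2-AJ (v4.6); companion of `Scaling/HierarchicalVolumeLaw.lean` (item 119a: `kerLaw`,
`condLaw`, the chain rule `klFin_kerLaw_eq`, the ESS identity `inv_essFrac_kerLaw_eq`, the law
`hierarchical_volume_law`).  Finite state spaces, laws of full support.  Two supplements:

* `condCov_le_condDefect` (conditional T2-N, from the tree's `CovDefect.abs_cov_le_tvDist_prodLaw`)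
  — if the conditional kernel is independent across a cut INSIDE fine block `i` given the coarse
  variable `c`, then for `1`-bounded `f`, `g` on the two sides
  `Σ_c r_C(c)·|Cov_r(f, g | c)| ≤ 6·Σ_c r_C(c)·TV(r(φ_i = ·|c), k_{c,i})`: the MEAN CONDITIONAL
  DEFECT that drives the hierarchical volume law is at least one sixth of the mean conditional
  connected cross-cut correlator given the coarse field (by the law of total covariance its signed
  mean is `Cov(f,g) − Cov(E[f|c], E[g|c])`, a measurable number) — the conditional form of the
  clustering hypothesis (U) of THEORY-2.md §3.1, hypothesis (U-c), NOT asserted here;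
* `klFin_kerLaw_blockProd_eq` / `inv_essFrac_kerLaw_blockProd_eq` — if the TARGET too is a product
  over the fine blocks given `c`, `r(c, φ) = b(c)·Π_i r_{c,i}(φ_i)` (a Markov field given a
  separator: domain decomposition [cite: Finkenrath2022, §3–4]), both budgets are EXACTLY additive
  / multiplicative: `D(r ‖ q) = D(b ‖ a) + Σ_c b(c)·Σ_i D(r_{c,i} ‖ k_{c,i})` and
  `1/ESS(r, q) = Σ_c (b(c)²/a(c))·Π_i 1/ESS(r_{c,i}, k_{c,i})` — a per-domain ESS defect still
  compounds over the domains of ONE global accept/reject step (T2-B fibrewise), which is the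
  printed observation that the acceptance of the global correction step of a domain-decomposed
  flow "decreases exponentially with the volume" [cite: Finkenrath2022, §4].

Helpers: `blockMarg_blockProd` (marginals of a normalised block product), `klFin_self`,
`klFin_blockProd_blockProd` (KL between block products is the sum of block KLs).
Elementary (`[folklore]`-level); farm `lean check` rc 0, no `sorry`.
-/

namespace Summit.Ventures.LatticeQCDFlow.Theory2

open Finset
open Literature.Probability.MarkovChains Literature.Probability.Entropy

variable {C : Type*} [Fintype C]

section Companion

variable {m : ℕ} {Z : Type*} [Fintype Z] [DecidableEq Z] [Nonempty Z]

/-! ## The conditional defect from a conditional connected correlator (conditional T2-N) -/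

omit [Nonempty Z] in
/-- **Conditional T2-N.**  Fine blocks with an internal cut (`Z = A × B`) and a kernel that is
independent across the cut given `c` (`k_{c,i} = k¹_{c,i} ⊗ k²_{c,i}`): for `1`-bounded `f` on
`A`, `g` on `B` and every block `i`,
`Σ_c r_C(c)·|E_r[f g | c] − E_r[f | c]·E_r[g | c]| ≤ 6·Σ_c r_C(c)·TV(r(φ_i = ·|c), k_{c,i})` —
the mean conditional defect is at least ONE SIXTH of the mean conditional connected correlator
across the cut given the coarse field. [folklore] -/
theorem condCov_le_condDefect {A B : Type*} [Fintype A] [Fintype B] [DecidableEq A]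
    [DecidableEq B] [Nonempty A] [Nonempty B] {r : C × (Fin m → A × B) → ℝ}
    (hr : ∀ z, 0 < r z) {k₁ : C → Fin m → A → ℝ} {k₂ : C → Fin m → B → ℝ}
    (hk₁1 : ∀ c i, ∑ x, k₁ c i x = 1) (hk₂ : ∀ c i y, 0 ≤ k₂ c i y)
    (hk₂1 : ∀ c i, ∑ y, k₂ c i y = 1) {f : A → ℝ} {g : B → ℝ} (hf : ∀ x, |f x| ≤ 1)
    (hg : ∀ y, |g y| ≤ 1) (i : Fin m) :
    ∑ c, margU r c * |∑ z, blockMarg (condLaw r c) i z * (f z.1 * g z.2)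
        - (∑ z, blockMarg (condLaw r c) i z * f z.1)
          * (∑ z, blockMarg (condLaw r c) i z * g z.2)|
      ≤ 6 * ∑ c, margU r c * tvDist (blockMarg (condLaw r c) i) (prodLaw (k₁ c i) (k₂ c i)) := by
  have hm : ∀ c, 0 < margU r c := margU_pos hr
  have hcpos : ∀ c φ, 0 < condLaw r c φ := condLaw_pos hr
  have hc1 : ∀ c, ∑ φ, condLaw r c φ = 1 := fun c => sum_condLaw (hm c).ne'
  have hle : ∀ c, |∑ z, blockMarg (condLaw r c) i z * (f z.1 * g z.2)
        - (∑ z, blockMarg (condLaw r c) i z * f z.1)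
          * (∑ z, blockMarg (condLaw r c) i z * g z.2)|
      ≤ 6 * tvDist (blockMarg (condLaw r c) i) (prodLaw (k₁ c i) (k₂ c i)) := fun c =>
    abs_cov_le_tvDist_prodLaw (fun z => (blockMarg_pos (hcpos c) i z).le)
      (by rw [sum_blockMarg, hc1]) (hk₁1 c i) (hk₂ c i) (hk₂1 c i) hf hg
  refine (sum_le_sum fun c _ => mul_le_mul_of_nonneg_left (hle c) (hm c).le).trans (le_of_eq ?_)
  rw [mul_sum]
  exact sum_congr rfl fun c _ => by ring

/-! ## Markov targets (domain decomposition): exact additivity -/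

omit [DecidableEq Z] [Nonempty Z] in
/-- Expectation of a one-block observable under a normalised block product (local copy of
`Exactness.sum_blockProd_mul_apply`, kept private to keep the imports minimal). -/
private theorem sum_blockProd_mul_apply_aux (qb : Fin m → Z → ℝ) (hq1 : ∀ i, ∑ z, qb i z = 1)
    (i : Fin m) (g : Z → ℝ) : ∑ φ, blockProd qb φ * g (φ i) = ∑ z, qb i z * g z := by
  classical
  have key : ∀ φ : Fin m → Z, blockProd qb φ * g (φ i)
      = blockProd (Function.update qb i (fun z => qb i z * g z)) φ := by
    intro φ
    unfold blockProd
    have h1 : ∀ j, Function.update qb i (fun z => qb i z * g z) j (φ j)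
        = Function.update (fun j => qb j (φ j)) i (qb i (φ i) * g (φ i)) j := by
      intro j
      by_cases hj : j = i
      · rw [hj]; simp
      · simp [hj]
    simp_rw [h1]
    rw [prod_update_of_mem (mem_univ i),
      prod_eq_mul_prod_sdiff_singleton_of_mem (mem_univ i) (fun j => qb j (φ j))]
    ring
  simp_rw [key]
  rw [sum_blockProd]
  have h2 : ∀ j, ∑ z, Function.update qb i (fun z => qb i z * g z) j z
      = Function.update (fun _ : Fin m => (1:ℝ)) i (∑ z, qb i z * g z) j := by
    intro j
    by_cases hj : j = i
    · rw [hj]; simp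
    · simp [hj, hq1 j]
  simp_rw [h2]
  rw [prod_update_of_mem (mem_univ i)]
  simp

omit [Nonempty Z] in
/-- Block marginals of a normalised block product are its factors. [folklore] -/
theorem blockMarg_blockProd {qb : Fin m → Z → ℝ} (hq1 : ∀ i, ∑ z, qb i z = 1) (i : Fin m)
    (z : Z) : blockMarg (blockProd qb) i z = qb i z := by
  have h1 := sum_mul_apply_eq_sum_blockMarg (blockProd qb) i (fun z' => if z' = z then 1 else 0)
  have h2 := sum_blockProd_mul_apply_aux qb hq1 i (fun z' => if z' = z then 1 else 0)
  rw [h2] at h1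
  simpa using h1.symm

omit [Nonempty Z] in
/-- `D(p ‖ p) = 0`. [folklore] -/
theorem klFin_self {Y : Type*} [Fintype Y] {p : Y → ℝ} (hp : ∀ y, 0 < p y) : klFin p p = 0 := by
  unfold klFin
  exact sum_eq_zero fun y _ => by rw [div_self (hp y).ne', Real.log_one, mul_zero]

omit [Nonempty Z] in
/-- KL between normalised block products is the sum of the block KLs. [folklore] -/
theorem klFin_blockProd_blockProd {pb qb : Fin m → Z → ℝ} (hp : ∀ i z, 0 < pb i z)
    (hp1 : ∀ i, ∑ z, pb i z = 1) (hq : ∀ i z, 0 < qb i z) :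
    klFin (blockProd pb) (blockProd qb) = ∑ i, klFin (pb i) (qb i) := by
  have hmarg : blockMarg (blockProd pb) = pb :=
    funext fun i => funext fun z => blockMarg_blockProd hp1 i z
  rw [klFin_blockProd_eq (blockProd_pos hp) hq, hmarg, klFin_self (blockProd_pos hp), zero_add]

/-- **Domain decomposition / Markov targets: exact additivity of the KL.**  If the target too is a
product over the fine blocks given the coarse variable, `r(c, φ) = b(c)·Π_i r_{c,i}(φ_i)`, then
`D(r ‖ q) = D(b ‖ a) + Σ_c b(c)·Σ_i D(r_{c,i} ‖ k_{c,i})`. [folklore] -/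
theorem klFin_kerLaw_blockProd_eq {b : C → ℝ} (hb : ∀ c, 0 < b c) {rb : C → Fin m → Z → ℝ}
    (hrb : ∀ c i z, 0 < rb c i z) (hrb1 : ∀ c i, ∑ z, rb c i z = 1) {a : C → ℝ}
    (ha : ∀ c, 0 < a c) {k : C → Fin m → Z → ℝ} (hk : ∀ c i z, 0 < k c i z) :
    klFin (kerLaw b fun c => blockProd (rb c)) (kerLaw a fun c => blockProd (k c))
      = klFin b a + ∑ c, b c * ∑ i, klFin (rb c i) (k c i) := by
  have hρ1 : ∀ c, ∑ φ, blockProd (rb c) φ = 1 := fun c => by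
    rw [sum_blockProd]; exact prod_eq_one fun i _ => hrb1 c i
  have hmarg : margU (kerLaw b fun c => blockProd (rb c)) = b :=
    funext fun c => by rw [margU_kerLaw, hρ1, mul_one]
  have hcond : ∀ c, condLaw (kerLaw b fun c => blockProd (rb c)) c = blockProd (rb c) :=
    fun c => funext fun φ => condLaw_kerLaw hb hρ1 c φ
  rw [klFin_kerLaw_eq (kerLaw_pos hb fun c φ => blockProd_pos (hrb c) φ) ha
    (fun c φ => blockProd_pos (hk c) φ), hmarg]
  congr 1
  refine sum_congr rfl fun c _ => ?_
  rw [hcond c, klFin_blockProd_blockProd (hrb c) (hrb1 c) (hk c)]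

omit [DecidableEq Z] in
/-- **Domain decomposition / Markov targets: exact factorisation of the ESS.**
`1/ESS(r, q) = Σ_c (b(c)²/a(c)) · Π_i 1/ESS(r_{c,i}, k_{c,i})` (T2-B fibrewise). [folklore] -/
theorem inv_essFrac_kerLaw_blockProd_eq {b : C → ℝ} (hb : ∀ c, 0 < b c) (hb1 : ∑ c, b c = 1)
    {rb : C → Fin m → Z → ℝ} (hrb : ∀ c i z, 0 < rb c i z) (hrb1 : ∀ c i, ∑ z, rb c i z = 1)
    {a : C → ℝ} (ha : ∀ c, 0 < a c) {k : C → Fin m → Z → ℝ} (hk : ∀ c i z, 0 < k c i z) :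
    (essFrac (kerLaw b fun c => blockProd (rb c)) (kerLaw a fun c => blockProd (k c)))⁻¹
      = ∑ c, b c ^ 2 / a c * ∏ i, (essFrac (rb c i) (k c i))⁻¹ := by
  have hρ1 : ∀ c, ∑ φ, blockProd (rb c) φ = 1 := fun c => by
    rw [sum_blockProd]; exact prod_eq_one fun i _ => hrb1 c i
  have hr1 : ∑ z, kerLaw b (fun c => blockProd (rb c)) z = 1 := by
    rw [sum_kerLaw]
    simp_rw [hρ1, mul_one]
    exact hb1
  have hmarg : margU (kerLaw b fun c => blockProd (rb c)) = b :=
    funext fun c => by rw [margU_kerLaw, hρ1, mul_one]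
  have hcond : ∀ c, condLaw (kerLaw b fun c => blockProd (rb c)) c = blockProd (rb c) :=
    fun c => funext fun φ => condLaw_kerLaw hb hρ1 c φ
  rw [inv_essFrac_kerLaw_eq (kerLaw_pos hb fun c φ => blockProd_pos (hrb c) φ) hr1 ha
    (fun c φ => blockProd_pos (hk c) φ), hmarg]
  refine sum_congr rfl fun c _ => ?_
  rw [hcond c, essFrac_blockProd (hk c) (hrb1 c), prod_inv_distrib]

end Companion

end Summit.Ventures.LatticeQCDFlow.Theory2
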